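import Summits.BirchSwinnertonDyer.BirchSwinnertonDyer.Theorems.PlecticLegsArtinBaseChangeLocal
import Summits.BirchSwinnertonDyer.BirchSwinnertonDyer.Theorems.AdditiveKolyvaginRoadLevelKolyvaginSystemsAdditiveSplitCompletion
import Summits.BirchSwinnertonDyer.Rank1Residual.X2.ResidualDevissageModules
import Literature.NumberTheory.EllipticCurves.Rank1Residual.Predicates
import Literature.NumberTheory.EllipticCurves.ShaRestriction
import Literature.NumberTheory.EllipticCurves.GaloisActionProofs
import Literature.NumberTheory.EllipticCurves.DivisionFieldRamificationDividesProofs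
import Literature.NumberTheory.EllipticCurves.BSDSelmerParityDokchitserBaseChangeProofs
import Literature.NumberTheory.EllipticCurves.GreenbergSelmer
import Literature.NumberTheory.GaloisRepresentations.DecompositionGroupOfCompletion
import HarnessLib

/-!
# Crux K1 `CumulativeHeegnerInclusionAtThree` (stmt-BirchSwinnertonDyer-24198), line `birth`, stub B1 —
# CELL TRANSPORT I: the rational line `Φ ≤ E[p]` over `ℚ` base-changed to a number field `K`, and the
# decomposition group at a prime of `ℚ` versus the decomposition group at a DEGREE-ONE prime of `K`

Lead prover bsd-line-chl-k1-p1 g2 (`--supports stmt-BirchSwinnertonDyer-24198`). Stub B1 of line `birth`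
is reduced (tree `…CumulativeHeegnerInclusionAtThreeResidualDevissage.finite_selmerAc_empty_pTorsion_of_line_devissage`,
p609974) to inputs about a `Γ_K`-stable line `Φ_K ≤ E_K[3]` over the Heegner field `K` and the action of
the decomposition group `D_{𝔭′} ≤ Γ_K` on `E_K[3]/Φ_K`, whereas the crux states its hypotheses over `ℚ`:
a rational line `Φ ≤ E[3](ℚ̄)` (`IsRationalLine`) and the NON-ANOMALOUS clause «for every prime `𝔓` of
`\bar ℤ` above `3`, `D_𝔓 ≤ Γ_ℚ` neither fixes `Φ` pointwise nor acts trivially on `E[3]/Φ`». This file is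
the dictionary (pure Galois theory and the functoriality of `E(\bar ℚ) ≃ E_K(\bar K)`):

* §1 `exists_geomTorsion_baseChange_equiv` — an additive isomorphism `t : E[n](ℚ̄) ≃ E_K[n](K̄)` with
  `t (res σ • P) = σ • t P` (`res = resGal K : Γ_K → Γ_ℚ`; tree `pointsMap`, `localPointsEquivGeomPoints`,
  `pointsMapOfEmb_bijective`).
* §2 **`decompositionSubgroup_le_of_map_decomp_le`** — for `K/ℚ` Galois, a place `w` of `K` over `v`
  with `e(w|v) = f(w|v) = 1`, and an OPEN subgroup `T ≤ Γ_ℚ`: if the restriction to `ℚ̄` of the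
  decomposition group `D_w = decomp w ≤ Γ_K` (chosen embedding `K̄ → K̄_w`) lies in `T`, then the whole
  decomposition group `D_𝔓 ≤ Γ_ℚ` of the prime `𝔓 = ι⁻¹ 𝔓₀(w)` of `\bar ℤ` below the chosen prime of `w` lies
  in `T`. Proof: `I_𝔓 ⊆ res(Γ_K)` at an unramified place (tree `inertia_le_range_absGaloisRestrict`) and
  `res⁻¹(D_𝔓) = D_{𝔓₀(w)} = D_w` (`comap_decompositionSubgroup_comap_absIntegersMap`,
  `decompositionSubgroup_adicCompletionPrime_eq_range`), so `I_𝔓 ⊆ res(D_w) ⊆ T`; a Frobenius `Φ_w` of `K`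
  restricts to a Frobenius of `ℚ` at `𝔓` up to inertia since `f = 1`
  (`absGaloisRestrict_mul_pow_inv_mem_inertia`), so some Frobenius `φ ∈ T`; and every `d ∈ D_𝔓` is
  `φⁿ · i · u` with `i ∈ I_𝔓`, `u ∈ T` (`exists_eq_frobenius_pow_mul_of_mem_decompositionSubgroup`, Neukirch
  I (9.4)).
* §3 the two instances for a rational line `Φ` (`T` = the pointwise stabiliser of `Φ`, resp. the
  subgroup acting trivially on `E[p]/Φ`; both open because `E[p]` is finite with open point stabilisers):
  `not_forall_decomp_smul_mem_eq` / `not_forall_decomp_smul_sub_mem` — the non-anomalous clause at the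
  primes of `\bar ℤ` above `v` transfers to the decomposition group `decomp w ≤ Γ_K` acting through `res`.
* §4 the `K`-side reading through `t` on a `Γ_K`-stable subgroup `S ≤ E_K[n]` corresponding to `Φ`
  (`S = t(Φ)`), in the currency of `X2.ResidualDevissageModules.StableSubgroup` (`S.Sub`, `S.Quot`):
  `not_forall_decomp_smul_sub_eq_of_corr`, `not_forall_decomp_smul_quot_eq_of_corr`, and the existence of
  such an `S` with `#S = #Φ` (`exists_stableSubgroup_corr`).

THEOREMS ONLY; no definition, no named fact, no `sorry`; imports no `Theses` module. BSD is not proved by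
any of this. References: [NeukirchANT1999] I §9 (9.4)–(9.6), II §8 (8.5); [SerreGaloisCohomology1997]
II.§1.1; [SilvermanAEC2009] VIII.§1; [GreenbergVatsal2000] §2 p. 28 (the line `Φ`).
-/

set_option autoImplicit false
-- `…BirchSwinnertonDyer.BirchSwinnertonDyer.Theorems…` is the problem's mandated namespace (D-0017).
set_option linter.dupNamespace false

noncomputable section

open scoped Classical

namespace Summit.BirchSwinnertonDyer.BirchSwinnertonDyer.Theorems.CumulativeHeegnerInclusionAtThreeLineBaseChange

open NumberField IsDedekindDomain Field WeierstrassCurve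
open Literature.NumberTheory.EllipticCurves Literature.NumberTheory.EllipticCurves.GreenbergSelmer
  Literature.NumberTheory.GaloisRepresentations IsDedekindDomain.HeightOneSpectrum
  Summit.BirchSwinnertonDyer.Rank1Residual.X2.ResidualDevissageModules

/-! ### §1 `E[n](ℚ̄) ≃ E_K[n](K̄)`, equivariant along `res : Γ_K → Γ_ℚ` -/

section TorsionBaseChange

variable (W : WeierstrassCurve ℚ) (K : Type) [Field K] [NumberField K]

/-- **The base-change isomorphism on `n`-torsion**, `t : E[n](ℚ̄) ≃ E_K[n](K̄)`, equivariant along the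
restriction `res = resGal K : Γ_K → Γ_ℚ` of the chosen embedding `ℚ̄ → K̄`: `t (res σ • P) = σ • t P`. It is
the bijection `E(ℚ̄) ≃ E_K(K̄)` (`pointsMapOfEmb_bijective`, `localPointsEquivGeomPoints`) restricted to
`n`-torsion. [cite: SilvermanAEC2009, VIII.§1 (E[m] under field extension)] [cite: SerreGaloisCohomology1997, II.§1.1] -/
theorem exists_geomTorsion_baseChange_equiv (n : ℤ) :
    ∃ t : W.geomTorsion n ≃+ (W.baseChange K).geomTorsion n,
      ∀ (σ : absoluteGaloisGroup K) (P : W.geomTorsion n), t (resGal (K := ℚ) K σ • P) = σ • t P := by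
  -- the bijection on all points
  let f : W.geomPoints →+ (W.baseChange K).geomPoints :=
    ((localPointsEquivGeomPoints W K : localPoints W K ≃+ (W.baseChange K).geomPoints) :
      localPoints W K →+ (W.baseChange K).geomPoints).comp (pointsMap W K)
  have hf_smul : ∀ (σ : absoluteGaloisGroup K) (P : W.geomPoints),
      f (resGal (K := ℚ) K σ • P) = σ • f P := fun σ P ↦ by
    change localPointsEquivGeomPoints W K (pointsMap W K (resGal (K := ℚ) K σ • P)) = _
    rw [pointsMap_smul, localPointsEquivGeomPoints_smul]
    rfl
  have hf_bij : Function.Bijective f :=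
    (localPointsEquivGeomPoints W K).bijective.comp (pointsMapOfEmb_bijective K W (closureEmb (K := ℚ) K))
  let e : W.geomPoints ≃+ (W.baseChange K).geomPoints := AddEquiv.ofBijective f hf_bij
  have he : ∀ P, e P = f P := fun _ ↦ rfl
  -- restrict to `n`-torsion
  have hmem : ∀ P : W.geomPoints, P ∈ W.geomTorsion n ↔ e P ∈ (W.baseChange K).geomTorsion n := by
    intro P
    refine (Submodule.mem_torsionBy_iff n P).trans ?_
    refine Iff.trans ?_ (Submodule.mem_torsionBy_iff n (e P)).symm
    rw [← map_zsmul, e.map_eq_zero_iff]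
  refine ⟨e.addSubgroupMap (W.geomTorsion n) |>.trans (AddEquiv.addSubgroupCongr ?_), fun σ P ↦ ?_⟩
  · ext Q
    constructor
    · rintro ⟨P, hP, rfl⟩
      exact (hmem P).mp hP
    · intro hQ
      refine ⟨e.symm Q, ?_, e.apply_symm_apply Q⟩
      exact (hmem (e.symm Q)).mpr (by rw [e.apply_symm_apply]; exact hQ)
  · apply Subtype.ext
    change e (((resGal (K := ℚ) K σ • P : W.geomTorsion n) : W.geomPoints)) =
      ((σ • _ : (W.baseChange K).geomTorsion n) : (W.baseChange K).geomPoints)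
    rw [AddSubgroup.torsionBy.coe_smul, AddSubgroup.torsionBy.coe_smul, he, hf_smul]
    rfl

end TorsionBaseChange

/-! ### §2 `D_𝔓 ≤ Γ_ℚ` versus `decomp w ≤ Γ_K` at a place `w` of degree one -/

section Decomposition

variable (K : Type) [Field K] [NumberField K] [IsGalois ℚ K]

/-- **The decomposition group of `ℚ` at `𝔓` is controlled by the decomposition group of `K` at a
degree-one place above it.** Let `K/ℚ` be Galois, `w ∣ v` a place of `K` with `e(w|v) = f(w|v) = 1`,
`𝔓₀ = 𝔓₀(w)` the prime of `\bar ℤ_K` cut out by the chosen embedding `K̄ → K̄_w` (so `D_{𝔓₀} = decomp w`)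
and `𝔓 = ι⁻¹ 𝔓₀` the prime of `\bar ℤ` below it. If an OPEN subgroup `T ≤ Γ_ℚ` contains `res(decomp w)`,
then `D_𝔓 ≤ T`: `I_𝔓 ⊆ res(res⁻¹ D_𝔓) = res(D_{𝔓₀}) ⊆ T` (unramified: `I_𝔓 ⊆ res Γ_K`), a Frobenius of
`K` at `𝔓₀` restricts to a Frobenius `φ` of `ℚ` at `𝔓` modulo `I_𝔓` (`f = 1`), so `φ ∈ T`, and `D_𝔓` is
generated by `φ`, `I_𝔓` and any open subgroup (Neukirch I (9.4)).
[cite: NeukirchANT1999, Ch. I §9 Prop. (9.4)–(9.6); Ch. II §8 (8.5)] -/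
theorem decompositionSubgroup_le_of_decomp_le {v : HeightOneSpectrum (𝓞 ℚ)}
    {w : HeightOneSpectrum (𝓞 K)} (hw : w.asIdeal.under (𝓞 ℚ) = v.asIdeal)
    (he : w.asIdeal.ramificationIdx (𝓞 ℚ) = 1) (hf : w.asIdeal.inertiaDeg (𝓞 ℚ) = 1)
    (T : Subgroup (absoluteGaloisGroup ℚ)) (hT : IsOpen (T : Set (absoluteGaloisGroup ℚ)))
    (hle : ∀ γ ∈ decomp w, absGaloisRestrict ℚ K γ ∈ T) :
    ((adicCompletionPrime K w).comap (absIntegersMap ℚ K)).decompositionSubgroup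
      (absoluteGaloisGroup ℚ) ≤ T := by
  set 𝔔 := adicCompletionPrime K w with h𝔔def
  have h𝔔 : 𝔔 ∈ w.primesAbove := adicCompletionPrime_mem_primesAbove K w
  set 𝔓 := 𝔔.comap (absIntegersMap ℚ K) with h𝔓def
  have h𝔓 : 𝔓 ∈ v.primesAbove := comap_absIntegersMap_mem_primesAbove hw h𝔔
  -- `D_𝔔 = decomp w`
  have hDw : 𝔔.decompositionSubgroup (absoluteGaloisGroup K) = decomp w := by
    rw [h𝔔def, decompositionSubgroup_adicCompletionPrime_eq_range]
    rfl
  -- `res⁻¹ D_𝔓 = D_𝔔`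
  have hcomap : ∀ γ : absoluteGaloisGroup K,
      absGaloisRestrict ℚ K γ ∈ 𝔓.decompositionSubgroup (absoluteGaloisGroup ℚ) → γ ∈ decomp w := by
    intro γ hγ
    have h : γ ∈ (𝔓.decompositionSubgroup (absoluteGaloisGroup ℚ)).comap
        (absGaloisRestrict ℚ K).toMonoidHom := hγ
    rw [h𝔓def, comap_decompositionSubgroup_comap_absIntegersMap ℚ K 𝔔, hDw] at h
    exact h
  -- `I_𝔓 ⊆ T`
  have he' : v.asIdeal.ramificationIdxIn (𝓞 K) = 1 := by
    haveI : w.asIdeal.IsPrime := w.isPrime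
    haveI : v.asIdeal.IsMaximal := v.isMaximal
    haveI : w.asIdeal.LiesOver v.asIdeal := ⟨hw.symm⟩
    haveI : IsGaloisGroup (K ≃ₐ[ℚ] K) (𝓞 ℚ) (𝓞 K) := IsGaloisGroup.of_isFractionRing _ _ _ ℚ K
    rw [Ideal.ramificationIdxIn_eq_ramificationIdx v.asIdeal w.asIdeal (K ≃ₐ[ℚ] K), he]
  have hI : ∀ i ∈ 𝔓.inertia (absoluteGaloisGroup ℚ), i ∈ T := by
    intro i hi
    obtain ⟨γ, hγ⟩ := inertia_le_range_absGaloisRestrict ℚ K he' h𝔓 hi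
    have hγ' : absGaloisRestrict ℚ K γ = i := hγ
    rw [← hγ']
    refine hle γ (hcomap γ ?_)
    rw [hγ']
    exact Ideal.inertia_le_decompositionSubgroup _ _ hi
  -- a Frobenius `φ ∈ T`
  obtain ⟨Φw, hΦw⟩ := HeightOneSpectrum.exists_isArithFrobAt_of_mem_primesAbove_holds h𝔔
  obtain ⟨φ, hφ⟩ := HeightOneSpectrum.exists_isArithFrobAt_of_mem_primesAbove_holds h𝔓
  have hrel : absGaloisRestrict ℚ K Φw * (φ ^ w.asIdeal.inertiaDeg (𝓞 ℚ))⁻¹ ∈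
      𝔓.inertia (absoluteGaloisGroup ℚ) :=
    absGaloisRestrict_mul_pow_inv_mem_inertia hw h𝔔 hΦw hφ
  rw [hf, pow_one] at hrel
  have hΦwD : Φw ∈ decomp w := by
    rw [← hDw]
    exact hΦw.mem_stabilizer
  have hφT : φ ∈ T := by
    have h1 : absGaloisRestrict ℚ K Φw ∈ T := hle Φw hΦwD
    have h2 : absGaloisRestrict ℚ K Φw * φ⁻¹ ∈ T := hI _ hrel
    have h3 : φ = (absGaloisRestrict ℚ K Φw * φ⁻¹)⁻¹ * absGaloisRestrict ℚ K Φw := by group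
    rw [h3]
    exact T.mul_mem (T.inv_mem h2) h1
  -- every element of `D_𝔓`
  intro d hd
  obtain ⟨n, i, u, hi, hu, rfl⟩ :=
    exists_eq_frobenius_pow_mul_of_mem_decompositionSubgroup h𝔓 hφ hT hd
  exact T.mul_mem (T.mul_mem (T.pow_mem hφT n) (hI i hi)) hu

end Decomposition

/-! ### §3 The non-anomalous clause over `ℚ` read on `decomp w ≤ Γ_K` -/

section Line

variable (W : WeierstrassCurve ℚ) [W.IsElliptic] (p : ℕ) [Fact p.Prime]
  (K : Type) [Field K] [NumberField K] [IsGalois ℚ K]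

omit [IsGalois ℚ K] in
/-- The pointwise stabiliser of the finite `Γ_ℚ`-set `E[p]` is an open subgroup (point stabilisers are
open, `isOpen_stabilizer_point_holds`; `E[p]` is finite). [cite: SerreGaloisCohomology1997, II.§1.1] -/
theorem isOpen_iInf_stabilizer_geomTorsion :
    IsOpen ((⨅ P : W.geomTorsion (p : ℤ),
      MulAction.stabilizer (absoluteGaloisGroup ℚ) (P : W.geomPoints) :
        Subgroup (absoluteGaloisGroup ℚ)) : Set (absoluteGaloisGroup ℚ)) := by
  haveI : Finite (W.geomTorsion (p : ℤ)) := by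
    apply Nat.finite_of_card_ne_zero
    rw [W.natCard_geomTorsion_prime_eq_sq (Fact.out : p.Prime)]
    exact pow_ne_zero 2 (Fact.out : p.Prime).ne_zero
  rw [Subgroup.coe_iInf]
  exact isOpen_iInter_of_finite fun P ↦ W.isOpen_stabilizer_point_holds (P : W.geomPoints)

variable {W p} (Φ : AddSubgroup (W.geomTorsion (p : ℤ)))

/-- **Non-anomalous clause (i) on `decomp w`.** If at every prime `𝔓` of `\bar ℤ` above `v` the
decomposition group `D_𝔓 ≤ Γ_ℚ` does NOT fix the line `Φ ≤ E[p]` pointwise, then neither does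
`res(decomp w)` for a degree-one place `w ∣ v` of the Galois number field `K` (§2 applied to the open
subgroup of `Γ_ℚ` fixing `Φ` pointwise). [cite: NeukirchANT1999, Ch. I §9 Prop. (9.4)–(9.6)] -/
theorem not_forall_decomp_smul_eq {v : HeightOneSpectrum (𝓞 ℚ)} {w : HeightOneSpectrum (𝓞 K)}
    (hw : w.asIdeal.under (𝓞 ℚ) = v.asIdeal) (he : w.asIdeal.ramificationIdx (𝓞 ℚ) = 1)
    (hf : w.asIdeal.inertiaDeg (𝓞 ℚ) = 1)
    (hcell : ∀ 𝔓 ∈ v.primesAbove,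
      ¬ (∀ g ∈ 𝔓.decompositionSubgroup (absoluteGaloisGroup ℚ), ∀ P ∈ Φ, g • P = P)) :
    ¬ ∀ γ ∈ decomp w, ∀ P ∈ Φ, absGaloisRestrict ℚ K γ • P = P := by
  intro h
  -- the open subgroup `T` of `Γ_ℚ` fixing `Φ` pointwise
  let T : Subgroup (absoluteGaloisGroup ℚ) :=
    { carrier := {g | ∀ P ∈ Φ, g • P = P}
      mul_mem' := fun {a b} ha hb P hP ↦ by rw [mul_smul, hb P hP, ha P hP]
      one_mem' := fun P _ ↦ one_smul _ P
      inv_mem' := fun {a} ha P hP ↦ by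
        conv_lhs => rw [← ha P hP]
        rw [inv_smul_smul] }
  have hTmem : ∀ g, g ∈ T ↔ ∀ P ∈ Φ, g • P = P := fun _ ↦ Iff.rfl
  have hT : IsOpen (T : Set (absoluteGaloisGroup ℚ)) := by
    refine Subgroup.isOpen_mono ?_ (isOpen_iInf_stabilizer_geomTorsion W p)
    intro g hg
    rw [hTmem]
    intro P _
    have hgP : g • (P : W.geomPoints) = P := by
      have := (Subgroup.mem_iInf.mp hg) P
      exact this
    exact Subtype.ext (by rw [AddSubgroup.torsionBy.coe_smul]; exact hgP)
  have hle : ∀ γ ∈ decomp w, absGaloisRestrict ℚ K γ ∈ T := fun γ hγ ↦ (hTmem _).mpr (h γ hγ)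
  have hD := decompositionSubgroup_le_of_decomp_le K hw he hf T hT hle
  exact hcell _ (comap_absIntegersMap_mem_primesAbove hw (adicCompletionPrime_mem_primesAbove K w))
    fun g hg ↦ (hTmem g).mp (hD hg)

/-- **Non-anomalous clause (ii) on `decomp w`.** If at every prime `𝔓` of `\bar ℤ` above `v` the
decomposition group `D_𝔓 ≤ Γ_ℚ` does NOT act trivially on `E[p]/Φ`, then neither does `res(decomp w)` for
a degree-one place `w ∣ v` of the Galois number field `K` (§2 applied to the open subgroup of `Γ_ℚ`
acting trivially modulo `Φ`). [cite: NeukirchANT1999, Ch. I §9 Prop. (9.4)–(9.6)] -/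
theorem not_forall_decomp_smul_sub_mem {v : HeightOneSpectrum (𝓞 ℚ)} {w : HeightOneSpectrum (𝓞 K)}
    (hw : w.asIdeal.under (𝓞 ℚ) = v.asIdeal) (he : w.asIdeal.ramificationIdx (𝓞 ℚ) = 1)
    (hf : w.asIdeal.inertiaDeg (𝓞 ℚ) = 1)
    (hcell : ∀ 𝔓 ∈ v.primesAbove,
      ¬ (∀ g ∈ 𝔓.decompositionSubgroup (absoluteGaloisGroup ℚ),
        ∀ P : W.geomTorsion (p : ℤ), g • P - P ∈ Φ)) :
    ¬ ∀ γ ∈ decomp w, ∀ P : W.geomTorsion (p : ℤ), absGaloisRestrict ℚ K γ • P - P ∈ Φ := by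
  intro h
  -- the open subgroup `T` of `Γ_ℚ` acting trivially on `E[p]/Φ`
  let T : Subgroup (absoluteGaloisGroup ℚ) :=
    { carrier := {g | ∀ P : W.geomTorsion (p : ℤ), g • P - P ∈ Φ}
      mul_mem' := fun {a b} ha hb P ↦ by
        have : (a * b) • P - P = (a • (b • P) - b • P) + (b • P - P) := by rw [mul_smul]; abel
        rw [this]
        exact Φ.add_mem (ha _) (hb _)
      one_mem' := fun P ↦ by rw [one_smul, sub_self]; exact Φ.zero_mem
      inv_mem' := fun {a} ha P ↦ by
        have : a⁻¹ • P - P = -(a • (a⁻¹ • P) - a⁻¹ • P) := by rw [smul_inv_smul]; abel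
        rw [this]
        exact Φ.neg_mem (ha _) }
  have hTmem : ∀ g, g ∈ T ↔ ∀ P : W.geomTorsion (p : ℤ), g • P - P ∈ Φ := fun _ ↦ Iff.rfl
  have hT : IsOpen (T : Set (absoluteGaloisGroup ℚ)) := by
    refine Subgroup.isOpen_mono ?_ (isOpen_iInf_stabilizer_geomTorsion W p)
    intro g hg
    rw [hTmem]
    intro P
    have hgP : g • (P : W.geomPoints) = P := by
      have := (Subgroup.mem_iInf.mp hg) P
      exact this
    have : g • P = P := Subtype.ext (by rw [AddSubgroup.torsionBy.coe_smul]; exact hgP)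
    rw [this, sub_self]
    exact Φ.zero_mem
  have hle : ∀ γ ∈ decomp w, absGaloisRestrict ℚ K γ ∈ T := fun γ hγ ↦ (hTmem _).mpr (h γ hγ)
  have hD := decompositionSubgroup_le_of_decomp_le K hw he hf T hT hle
  exact hcell _ (comap_absIntegersMap_mem_primesAbove hw (adicCompletionPrime_mem_primesAbove K w))
    fun g hg ↦ (hTmem g).mp (hD hg)

end Line

/-! ### §4 The `K`-side reading on a stable subgroup `S ≤ E_K[n]` corresponding to `Φ` under `t` -/

section KSide

variable {W : WeierstrassCurve ℚ} {n : ℤ} {K : Type} [Field K] [NumberField K]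
  (Φ : AddSubgroup (W.geomTorsion n))
  (t : W.geomTorsion n ≃+ (W.baseChange K).geomTorsion n)
  (ht : ∀ (σ : absoluteGaloisGroup K) (P : W.geomTorsion n), t (absGaloisRestrict ℚ K σ • P) = σ • t P)
  (S : StableSubgroup (absoluteGaloisGroup K) ((W.baseChange K).geomTorsion n))
  (hS : ∀ Q : (W.baseChange K).geomTorsion n, Q ∈ S.toAddSubgroup ↔ t.symm Q ∈ Φ)

include ht hS in
/-- `K`-side reading of clause (i): if `res(decomp w)` does not fix `Φ` pointwise then `decomp w` does not
fix the corresponding stable subgroup `S = t(Φ) ≤ E_K[n]` pointwise. [folklore] -/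
theorem not_forall_decomp_smul_sub_eq_of_corr {w : HeightOneSpectrum (𝓞 K)}
    (h : ¬ ∀ γ ∈ decomp w, ∀ P ∈ Φ, absGaloisRestrict ℚ K γ • P = P) :
    ¬ ∀ γ ∈ decomp w, ∀ x : S.Sub, γ • x = x := by
  intro h'
  apply h
  intro γ hγ P hP
  have hx : t P ∈ S.toAddSubgroup := (hS _).mpr (by rw [t.symm_apply_apply]; exact hP)
  have h1 := congrArg S.incl (h' γ hγ ⟨t P, hx⟩)
  rw [StableSubgroup.incl_smul] at h1
  change γ • t P = t P at h1
  rw [← ht] at h1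
  exact t.injective h1

include ht hS in
/-- `K`-side reading of clause (ii): if `res(decomp w)` does not act trivially on `E[n]/Φ` then `decomp w`
does not act trivially on `E_K[n]/S` for the corresponding stable subgroup `S = t(Φ)`. [folklore] -/
theorem not_forall_decomp_smul_quot_eq_of_corr {w : HeightOneSpectrum (𝓞 K)}
    (h : ¬ ∀ γ ∈ decomp w, ∀ P : W.geomTorsion n, absGaloisRestrict ℚ K γ • P - P ∈ Φ) :
    ¬ ∀ γ ∈ decomp w, ∀ y : S.Quot, γ • y = y := by
  intro h'
  apply h
  intro γ hγ P
  have h1 := (S.forall_smul_quot_eq_self_iff γ).mp (h' γ hγ) (t P)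
  rw [← ht, ← map_sub, hS, t.symm_apply_apply] at h1
  exact h1

include ht in
/-- **The base-changed line.** For a `Γ_ℚ`-stable subgroup `Φ ≤ E[n](ℚ̄)`, its image `S = t(Φ) ≤ E_K[n](K̄)`
is a `Γ_K`-stable subgroup (packaged as a `StableSubgroup`) corresponding to `Φ` under `t`, of the same
order. [cite: GreenbergVatsal2000, §2 p. 28 (the line Φ)] [cite: SilvermanAEC2009, VIII.§1] -/
theorem exists_stableSubgroup_corr (hΦ : ∀ (σ : absoluteGaloisGroup ℚ), ∀ P ∈ Φ, σ • P ∈ Φ) :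
    ∃ S : StableSubgroup (absoluteGaloisGroup K) ((W.baseChange K).geomTorsion n),
      (∀ Q : (W.baseChange K).geomTorsion n, Q ∈ S.toAddSubgroup ↔ t.symm Q ∈ Φ) ∧
        Nat.card S.Sub = Nat.card Φ := by
  have hsmul : ∀ (g : absoluteGaloisGroup K) (Q : (W.baseChange K).geomTorsion n),
      t.symm (g • Q) = absGaloisRestrict ℚ K g • t.symm Q := fun g Q ↦ by
    apply t.injective
    rw [t.apply_symm_apply, ht, t.apply_symm_apply]
  refine ⟨⟨Φ.comap t.symm.toAddMonoidHom, fun g {Q} hQ ↦ ?_⟩, fun Q ↦ Iff.rfl, ?_⟩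
  · change t.symm (g • Q) ∈ Φ
    rw [hsmul]
    exact hΦ _ _ hQ
  · refine Nat.card_congr
      { toFun := fun x ↦ ⟨t.symm x.1, x.2⟩
        invFun := fun P ↦ ⟨t P, show t.symm (t P) ∈ Φ by rw [t.symm_apply_apply]; exact P.2⟩
        left_inv := fun x ↦ Subtype.ext (t.apply_symm_apply x.1)
        right_inv := fun P ↦ Subtype.ext (t.symm_apply_apply P.1) }

end KSide


end Summit.BirchSwinnertonDyer.BirchSwinnertonDyer.Theorems.CumulativeHeegnerInclusionAtThreeLineBaseChange

end
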